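import Summits.QuantumFields.YangMills.Theorems.UnitScaleTiltProp7FibreQDefect
import HarnessLib

/-!
# Route `UnitScaleTilt`, crux K1 child «MinimiserStabilityRegPr» (stmt-QuantumFields-19200), route-R GROWTH (MAP #3 M10, S3 «nonlinear passage»), brick (b) in `ℓ²` AT A CURVED
# BACKGROUND: the framed linearised-constraint defects of a fibre pair, summed over the coarse bonds with bond-dependent stencil gauges `σ_c`, under the displayed local radii and
# interior mean-value input — `Σ_c‖Q^{(k)}(W^{σ_c} − U₀^{σ_c})(c)‖² ≤ (C₂(d+1)Lᵏ)²·(m(s) + m(η))²·C_reg(Lᵏ)⁻³·2d·Σ_b‖W_b − U₀,b‖²`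

Cell `ym3-torus`, keyed width hand `ym-routeR-w3` (D-0154 (3c); MAP #3 row M10 (b); sequel of `…Prop7FibreQDefect`).  THEOREMS ONLY (0 `def`, 0 `sorry`); `--supports stmt-QuantumFields-19200`,
count-neutral.  YM₃ on T³ is a ladder rung (R3), not the Clay problem; nothing here claims the stub, the crux, d = 4 or the mass gap.

WHAT.  `…Prop7FibreQDefect.norm_linAvgIterM_gauged_sub_le_of_iter_eq` gives, per coarse bond `c` and ANY stencil gauge `σ`, `‖Q^{(k)}(W^σ − U₀^σ)(c)‖ ≤ C₂·m(ρ_c)(m(ρ_c) + m(η))` from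
the fibre identity at `c`, `η`-flatness of `U₀^σ` and the local radius `ρ_c` on the two `k`-blocks of `c`.  Here the gauges are a FAMILY `σ : PBond P k → GaugeTransf` (★w4-19200's
(T1): the centre-axial gauge of each two-block box, `η = 3ε₀L^{−(K−n)}`), and the per-bond rows are summed with `…Prop7FibreQDefect.sum_sq_le_of_localSup_of_localReg`:
★★ `sum_normSq_linAvgIterM_gauged_sub_le_of_localReg` (mean-value input over the SAME two blocks, overlap `2d`).  Since a same-domain mean-value inequality is not k-uniform even for
lattice-harmonic data (★w1-19200 g6 LOCATED 06:48Z: `sup²∕(ℓ⁻³·mass) ≍ degree`), §0 re-does the bookkeeping for an ARBITRARY STENCIL RELATION `S c b` («the fine bond `b` lies in the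
enlarged neighbourhood of `c`») with a displayed overlap multiplicity `ν` (`Σ_c 𝟙[S c b] ≤ ν`, e.g. `(2r+1)^d·2d` for the `r`-block neighbourhood): `sum_sum_ite_le_of_overlap`,
`sum_sq_le_of_localSup_of_localReg_stencil`; the sup radius `ρ_c` stays on the two blocks of `c`, only the MASS side of the mean-value input moves to the stencil.  ★★
`sum_normSq_linAvgIterM_sub_one_le_of_localReg_stencil` (flat datum) and ★★ `sum_normSq_linAvgIterM_gauged_sub_le_of_localReg_stencil` (curved, gauges `σ_c`) are the
consumable forms (overlap `ν` in place of `2d`); §3 ★ `norm_iterDiff_sub_linAvgIterM_gauged_le` is the FIBRE-FREE per-bond row (the zeroth-order term `avg^k(W^σ)(c) − avg^k(U₀^σ)(c)`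
DISPLAYED — for the unpinned ∕ Landau branch, where it is the coarse pure gauge `g↓`).  The mass on the right is `Σ_b‖W_b − U₀,b‖² = Σ_b‖W_bU₀(b)^* − 1‖²` (`norm_sub_eq_norm_pertVar`, unitary invariance), i.e. the
`Σ‖Y‖²` of the passage files.  NUMBERS: the right side is `(C₂(d+1)Lᵏ)²·((d+1)Lᵏ(s+η))²·C_reg(Lᵏ)⁻³·2d·Σ‖Y‖² = [2d(d+1)⁴C₂²C_reg]·(Lᵏ(s+η))²·(Lᵏ)⁻¹·Σ‖Y‖²`; at `s = ε₂L^{−k}`,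
`η = 3ε₀L^{−k}` this is `O((ε₂+ε₀)²)·(Lᵏ)⁻¹·Σ‖Y‖²` — in N8's currency `28Lᵏ·Σ_c‖Q^{(k)}Y(c)‖²_F` a cost `O((ε₂+ε₀)²)·Σ‖Y‖²`, in S2′'s (`E₂(c) = L^{3k}q_c`, weight `32L^{−7k}`) a cost
`O((ε₂+ε₀)²)·L^{−2k}Σ‖Y‖²`, k-UNIFORM either way.  (ERRATUM to the docstrings of `…Prop7FibreQDefect` §4 ∕ module header, ✓ p609586: the displayed product there equals
`[2d(d+1)⁴C₂²C_reg]·(Lᵏs)²·(Lᵏ)⁻¹·Σ‖W_b − 1‖²` — `(Lᵏ)⁻¹`, not `Lᵏ`; the THEOREM STATEMENT carries the explicit product and is unaffected, and the stated N8∕S2′ costs `O(ε₂²)` are right.)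
NOT here: the junction of the framed flat linearisation `Q^{(k)}(W^{σ_c} − U₀^{σ_c})`
with the curved N6's covariant linearisation ((R-A) `covIterLin`), the gauges `σ_c` themselves ((T1)∕(T2)), and the interior mean-value input `C_reg` (the card's OPEN `s_loc` regularity;
it FAILS at charged centres of the pinned optimum by `L^{3k}` — the S2″ fork, decided elsewhere).

References: T. Bałaban, Commun. Math. Phys. 98 (1985) 17–51 [Balaban1985Averaging] ((11)–(13) p.19, Prop. 4 (134)–(135) p.38, Prop. 5 (156)–(157) p.42); CMP 102 (1985) 277–309
[Balaban1985Variational] ((4)–(8) pp.278–279, (15) p.280); CMP 109 (1987) 249–301 [Balaban1987RG1] ((0.4), (0.11) p.253).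
-/

set_option autoImplicit false

noncomputable section

open scoped Matrix.Norms.L2Operator

namespace Summit.QuantumFields.YangMills.Theorems.Prop7FibreQDefectEll2

open Literature.MathematicalPhysics.QuantumFieldTheory.Balaban1983to89
open Literature.MathematicalPhysics.QuantumFieldTheory.Balaban1983to89.B5Eq118OneStroke (iterBlockOf)
open T4Continuum BlockAveraging ExpMeanLog BlockAveragingEMLLinearised
open Summit.QuantumFields.YangMills.Theorems.LinearLiftMatrix (linAvgIterM)
open Summit.QuantumFields.YangMills.Theorems.Prop7FibreQDefect (norm_linAvgIterM_gauged_sub_le_of_iter_eq sum_sq_le_of_localSup_of_localReg)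

variable {P : Params} {n : Type*} [Fintype n] [DecidableEq n] [Nonempty n]

omit [Nonempty n] in
/-- `‖W − U₀‖ = ‖WU₀^* − 1‖` bondwise (`U₀ ∈ SU(n)`): the mass of this file is the `Σ‖Y‖²` of the passage files. [folklore] -/
theorem norm_sub_eq_norm_pertVar (W U₀ : Matrix.specialUnitaryGroup n ℂ) :
    ‖(W : Matrix n n ℂ) - (U₀ : Matrix n n ℂ)‖ = ‖(W : Matrix n n ℂ) * star (U₀ : Matrix n n ℂ) - 1‖ := by
  rw [← NewtonDefectMap.norm_defect_sub_defect_eq (W : Matrix n n ℂ) (U₀ : Matrix n n ℂ) U₀, Prop7HolRatioPerStep.coe_mul_star_self]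

/-! ## §0 The `ℓ²` bookkeeping with an arbitrary stencil relation and a displayed overlap multiplicity -/

section Stencil

variable {k : ℕ}

/-- **OVERLAP BOOKKEEPING FOR AN ARBITRARY STENCIL**: if every fine bond `b` belongs to the stencil of at most `ν` coarse bonds (`Σ_c 𝟙[S c b] ≤ ν`), then
`Σ_c Σ_{b : S c b} f(b) ≤ ν·Σ_b f(b)` for `f ≥ 0`. [folklore] -/
theorem sum_sum_ite_le_of_overlap (S : PBond P k → PBond P 0 → Prop) [∀ c b, Decidable (S c b)] (f : PBond P 0 → ℝ) (hf : ∀ b, 0 ≤ f b) {ν : ℝ}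
    (hν : ∀ b : PBond P 0, ∑ c : PBond P k, (if S c b then (1 : ℝ) else 0) ≤ ν) :
    ∑ c : PBond P k, ∑ b : PBond P 0, (if S c b then f b else 0) ≤ ν * ∑ b : PBond P 0, f b := by
  rw [Finset.sum_comm, Finset.mul_sum]
  refine Finset.sum_le_sum fun b _ => ?_
  have e : ∑ c : PBond P k, (if S c b then f b else 0) = f b * ∑ c : PBond P k, (if S c b then (1 : ℝ) else 0) := by
    rw [Finset.mul_sum]
    refine Finset.sum_congr rfl fun c _ => ?_
    split_ifs <;> simp
  rw [e, mul_comm]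
  exact mul_le_mul_of_nonneg_right (hν b) (hf b)

/-- **THE `ℓ²` SUM OF A LOCALLY-SUP-QUADRATIC DEFECT UNDER A STENCIL MEAN-VALUE INPUT**: per coarse bond `c`, `q_c ≤ A·ρ_c·(B·ρ_c + D)`, `0 ≤ ρ_c ≤ s`, and the displayed input
`ρ_c² ≤ C_reg·V⁻¹·Σ_{b : S c b} f(b)` over an ARBITRARY stencil relation `S` of overlap multiplicity `ν`; THEN `Σ_c q_c² ≤ A²(Bs + D)²·(C_reg·V⁻¹)·(ν·Σ_b f(b))`. [folklore] -/
theorem sum_sq_le_of_localSup_of_localReg_stencil (S : PBond P k → PBond P 0 → Prop) [∀ c b, Decidable (S c b)] {ν : ℝ}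
    (hν : ∀ b : PBond P 0, ∑ c : PBond P k, (if S c b then (1 : ℝ) else 0) ≤ ν)
    (q ρ : PBond P k → ℝ) (f : PBond P 0 → ℝ) (hf : ∀ b, 0 ≤ f b)
    {A B D s Creg V : ℝ} (hA : 0 ≤ A) (hB : 0 ≤ B) (hD : 0 ≤ D) (hCreg : 0 ≤ Creg) (hV : 0 < V)
    (hq : ∀ c, q c ≤ A * ρ c * (B * ρ c + D)) (hq0 : ∀ c, 0 ≤ q c) (hρ0 : ∀ c, 0 ≤ ρ c) (hρs : ∀ c, ρ c ≤ s)
    (hreg : ∀ c : PBond P k, ρ c ^ 2 ≤ Creg * V⁻¹ * ∑ b : PBond P 0, (if S c b then f b else 0)) :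
    ∑ c : PBond P k, q c ^ 2 ≤ A ^ 2 * (B * s + D) ^ 2 * (Creg * V⁻¹) * (ν * ∑ b : PBond P 0, f b) := by
  have hs0 : ∀ c : PBond P k, 0 ≤ s := fun c => (hρ0 c).trans (hρs c)
  have hper : ∀ c : PBond P k, q c ^ 2 ≤ A ^ 2 * (B * s + D) ^ 2 * ρ c ^ 2 := by
    intro c
    have h1 : q c ≤ A * (B * s + D) * ρ c := by
      have : B * ρ c + D ≤ B * s + D := by nlinarith [hρs c]
      calc q c ≤ A * ρ c * (B * ρ c + D) := hq c
        _ ≤ A * ρ c * (B * s + D) := mul_le_mul_of_nonneg_left this (mul_nonneg hA (hρ0 c))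
        _ = A * (B * s + D) * ρ c := by ring
    have h0 : 0 ≤ A * (B * s + D) * ρ c := by
      have := hs0 c
      have : 0 ≤ B * s + D := by nlinarith
      exact mul_nonneg (mul_nonneg hA this) (hρ0 c)
    calc q c ^ 2 ≤ (A * (B * s + D) * ρ c) ^ 2 := pow_le_pow_left₀ (hq0 c) h1 2
      _ = A ^ 2 * (B * s + D) ^ 2 * ρ c ^ 2 := by ring
  have hK0 : 0 ≤ A ^ 2 * (B * s + D) ^ 2 := by positivity
  calc ∑ c : PBond P k, q c ^ 2 ≤ ∑ c : PBond P k, A ^ 2 * (B * s + D) ^ 2 * ρ c ^ 2 := Finset.sum_le_sum fun c _ => hper c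
    _ = A ^ 2 * (B * s + D) ^ 2 * ∑ c : PBond P k, ρ c ^ 2 := by rw [Finset.mul_sum]
    _ ≤ A ^ 2 * (B * s + D) ^ 2 * ∑ c : PBond P k, (Creg * V⁻¹ * ∑ b : PBond P 0, (if S c b then f b else 0)) :=
        mul_le_mul_of_nonneg_left (Finset.sum_le_sum fun c _ => hreg c) hK0
    _ = A ^ 2 * (B * s + D) ^ 2 * (Creg * V⁻¹) * ∑ c : PBond P k, ∑ b : PBond P 0, (if S c b then f b else 0) := by
        rw [← Finset.mul_sum]; ring
    _ ≤ A ^ 2 * (B * s + D) ^ 2 * (Creg * V⁻¹) * (ν * ∑ b : PBond P 0, f b) :=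
        mul_le_mul_of_nonneg_left (sum_sum_ite_le_of_overlap S f hf hν) (by positivity)

end Stencil

/-! ## §1 Curved background, stencil gauges bond by bond — two-block mean-value input (overlap `2d`) -/

/-- ★★ **BRICK (b) IN `ℓ²` AT A CURVED BACKGROUND, STENCIL GAUGES BOND BY BOND, LOCAL RADII AND MEAN-VALUE INPUT DISPLAYED.**  `k ≤ m + K`; `W`, `U₀` finest `SU(n)` fields with the same
`k`-fold (0.4)-average (`avg^k W = avg^k U₀`); a family of finest gauges `σ_c`; on the bonds inside the two `k`-blocks of `c`: `‖(U₀^{σ_c})_b − 1‖ ≤ η` and `‖W_b − U₀,b‖ ≤ ρ_c ≤ s`; the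
smallness rows of the two-field theorem at `(s, η)`; the mean-value input `ρ_c² ≤ C_reg·(Lᵏ)⁻³·Σ_{b⊂B^k(c₋)∪B^k(c₊)}‖W_b − U₀,b‖²`.  THEN
`Σ_c‖Q^{(k)}(b ↦ (W^{σ_c})_b − (U₀^{σ_c})_b)(c)‖² ≤ (C₂·(d+1)Lᵏ)²·((d+1)Lᵏ·s + (d+1)Lᵏ·η)²·(C_reg·((Lᵏ)³)⁻¹)·(2d·Σ_b‖W_b − U₀,b‖²)`.
[cite: Balaban1985Averaging, (11)–(13) p.19, Prop. 4 (134)–(135) p.38, Prop. 5 (156)–(157) p.42; Balaban1987RG1, (0.4)+(0.11) p.253] -/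
theorem sum_normSq_linAvgIterM_gauged_sub_le_of_localReg {k : ℕ} (hk : k ≤ P.m + P.K)
    (σ : PBond P k → GaugeTransf P 0 (Matrix.specialUnitaryGroup n ℂ))
    (W U₀ : GaugeField P 0 (Matrix.specialUnitaryGroup n ℂ))
    (hfib : ∀ c : PBond P k, Averaging.iter (fun i => blockAvg (P := P) (j := i) (expMeanLogSU (n := n))) k W c =
      Averaging.iter (fun i => blockAvg (P := P) (j := i) (expMeanLogSU (n := n))) k U₀ c)
    {s η Creg : ℝ} (hη0 : 0 ≤ η) (hCreg : 0 ≤ Creg) (ρ : PBond P k → ℝ) (hρ0 : ∀ c, 0 ≤ ρ c) (hρs : ∀ c, ρ c ≤ s)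
    (hU₀ : ∀ (c : PBond P k) (b : PBond P 0), (iterBlockOf k b.src = c.src ∨ iterBlockOf k b.src = c.tgt) → (iterBlockOf k b.tgt = c.src ∨ iterBlockOf k b.tgt = c.tgt) →
      ‖((GaugeField.gaugeAct (σ c) U₀ b : Matrix.specialUnitaryGroup n ℂ) : Matrix n n ℂ) - 1‖ ≤ η)
    (hρ : ∀ (c : PBond P k) (b : PBond P 0), (iterBlockOf k b.src = c.src ∨ iterBlockOf k b.src = c.tgt) → (iterBlockOf k b.tgt = c.src ∨ iterBlockOf k b.tgt = c.tgt) →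
      ‖((W b : Matrix.specialUnitaryGroup n ℂ) : Matrix n n ℂ) - ((U₀ b : Matrix.specialUnitaryGroup n ℂ) : Matrix n n ℂ)‖ ≤ ρ c)
    (hreg : ∀ c : PBond P k, ρ c ^ 2 ≤ Creg * (((P.L : ℝ) ^ k) ^ 3)⁻¹ * ∑ b : PBond P 0,
        (if ((iterBlockOf k b.src = c.src ∨ iterBlockOf k b.src = c.tgt) ∧ (iterBlockOf k b.tgt = c.src ∨ iterBlockOf k b.tgt = c.tgt))
          then ‖((W b : Matrix.specialUnitaryGroup n ℂ) : Matrix n n ℂ) - ((U₀ b : Matrix.specialUnitaryGroup n ℂ) : Matrix n n ℂ)‖ ^ 2 else 0))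
    (hmδ : (((P.d : ℝ) + 1) * ((18 : ℝ) ^ P.d * (2 + ((P.d : ℝ) + 1) * (18 : ℝ) ^ P.d)) * (324 * (((P.d + 2) * P.L : ℕ) : ℝ) ^ 2) /
        ((P.L : ℝ) * ((P.L : ℝ) - 1))) * (((P.d : ℝ) + 1) * (P.L : ℝ) ^ k * η) ≤ 1)
    (h200 : 200 * (((P.d + 2) * P.L : ℕ) : ℝ) * (((P.d : ℝ) + 1) * (P.L : ℝ) ^ k * s + ((P.d : ℝ) + 1) * (P.L : ℝ) ^ k * η) ≤ 1)
    (hm : (((P.d : ℝ) + 1) * ((18 : ℝ) ^ P.d * (2 + ((P.d : ℝ) + 1) * (18 : ℝ) ^ P.d)) * (5200 * (((P.d + 2) * P.L : ℕ) : ℝ) ^ 2) /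
        ((P.L : ℝ) * ((P.L : ℝ) - 1))) * (((P.d : ℝ) + 1) * (P.L : ℝ) ^ k * s + ((P.d : ℝ) + 1) * (P.L : ℝ) ^ k * η) ≤ 1)
    (hNδ : 4 * (((P.d + 2) * P.L : ℕ) : ℝ) * (((P.d : ℝ) + 1) * (P.L : ℝ) ^ k * s + ((P.d : ℝ) + 1) * (P.L : ℝ) ^ k * η) < deltaSU n) :
    ∑ c : PBond P k, ‖linAvgIterM k (fun b => ((GaugeField.gaugeAct (σ c) W b : Matrix.specialUnitaryGroup n ℂ) : Matrix n n ℂ)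
        - ((GaugeField.gaugeAct (σ c) U₀ b : Matrix.specialUnitaryGroup n ℂ) : Matrix n n ℂ)) c‖ ^ 2
      ≤ ((((P.d : ℝ) + 1) * ((18 : ℝ) ^ P.d * (2 + ((P.d : ℝ) + 1) * (18 : ℝ) ^ P.d)) * (5200 * (((P.d + 2) * P.L : ℕ) : ℝ) ^ 2) /
            ((P.L : ℝ) * ((P.L : ℝ) - 1))) * (((P.d : ℝ) + 1) * (P.L : ℝ) ^ k)) ^ 2
          * ((((P.d : ℝ) + 1) * (P.L : ℝ) ^ k) * s + ((P.d : ℝ) + 1) * (P.L : ℝ) ^ k * η) ^ 2 * (Creg * (((P.L : ℝ) ^ k) ^ 3)⁻¹)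
          * (2 * P.d * ∑ b : PBond P 0, ‖((W b : Matrix.specialUnitaryGroup n ℂ) : Matrix n n ℂ) - ((U₀ b : Matrix.specialUnitaryGroup n ℂ) : Matrix n n ℂ)‖ ^ 2) := by
  classical
  have hL1 : (1 : ℝ) < P.L := by exact_mod_cast P.hL.2
  have hL0 : (0 : ℝ) < P.L := by linarith
  have hLL : 0 < (P.L : ℝ) * ((P.L : ℝ) - 1) := mul_pos hL0 (by linarith)
  have hC0 : 0 ≤ (((P.d : ℝ) + 1) * ((18 : ℝ) ^ P.d * (2 + ((P.d : ℝ) + 1) * (18 : ℝ) ^ P.d)) * (5200 * (((P.d + 2) * P.L : ℕ) : ℝ) ^ 2) /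
      ((P.L : ℝ) * ((P.L : ℝ) - 1))) := div_nonneg (by positivity) hLL.le
  have hm0 : 0 ≤ ((P.d : ℝ) + 1) * (P.L : ℝ) ^ k := by positivity
  have hcast0 : (0 : ℝ) ≤ (((P.d + 2) * P.L : ℕ) : ℝ) := Nat.cast_nonneg _
  have hmη0 : 0 ≤ ((P.d : ℝ) + 1) * (P.L : ℝ) ^ k * η := by positivity
  -- per coarse bond, with the smallness rows transported from `s` to `ρ_c ≤ s`
  have hq : ∀ c : PBond P k, ‖linAvgIterM k (fun b => ((GaugeField.gaugeAct (σ c) W b : Matrix.specialUnitaryGroup n ℂ) : Matrix n n ℂ)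
        - ((GaugeField.gaugeAct (σ c) U₀ b : Matrix.specialUnitaryGroup n ℂ) : Matrix n n ℂ)) c‖
      ≤ ((((P.d : ℝ) + 1) * ((18 : ℝ) ^ P.d * (2 + ((P.d : ℝ) + 1) * (18 : ℝ) ^ P.d)) * (5200 * (((P.d + 2) * P.L : ℕ) : ℝ) ^ 2) /
            ((P.L : ℝ) * ((P.L : ℝ) - 1))) * (((P.d : ℝ) + 1) * (P.L : ℝ) ^ k)) * ρ c
          * ((((P.d : ℝ) + 1) * (P.L : ℝ) ^ k) * ρ c + ((P.d : ℝ) + 1) * (P.L : ℝ) ^ k * η) := by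
    intro c
    have hmono : ((P.d : ℝ) + 1) * (P.L : ℝ) ^ k * ρ c + ((P.d : ℝ) + 1) * (P.L : ℝ) ^ k * η ≤ ((P.d : ℝ) + 1) * (P.L : ℝ) ^ k * s + ((P.d : ℝ) + 1) * (P.L : ℝ) ^ k * η :=
      add_le_add (mul_le_mul_of_nonneg_left (hρs c) hm0) le_rfl
    have hsum0 : 0 ≤ ((P.d : ℝ) + 1) * (P.L : ℝ) ^ k * ρ c + ((P.d : ℝ) + 1) * (P.L : ℝ) ^ k * η := add_nonneg (by have := hρ0 c; positivity) hmη0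
    have h := norm_linAvgIterM_gauged_sub_le_of_iter_eq (n := n) hk (σ c)
      {x : Site P 0 | iterBlockOf k x = c.src ∨ iterBlockOf k x = c.tgt} c (fun x hx => hx) W U₀ (hfib c) (hρ0 c) hη0
      (fun b h1 h2 => hU₀ c b h1 h2) (fun b h1 h2 => hρ c b h1 h2) hmδ
      ((mul_le_mul_of_nonneg_left hmono (by positivity)).trans h200)
      ((mul_le_mul_of_nonneg_left hmono hC0).trans hm)
      (lt_of_le_of_lt (mul_le_mul_of_nonneg_left hmono (by positivity)) hNδ)
    calc _ ≤ _ := h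
      _ = _ := by ring
  exact sum_sq_le_of_localSup_of_localReg
    (fun c => ‖linAvgIterM k (fun b => ((GaugeField.gaugeAct (σ c) W b : Matrix.specialUnitaryGroup n ℂ) : Matrix n n ℂ)
        - ((GaugeField.gaugeAct (σ c) U₀ b : Matrix.specialUnitaryGroup n ℂ) : Matrix n n ℂ)) c‖) ρ
    (fun b => ‖((W b : Matrix.specialUnitaryGroup n ℂ) : Matrix n n ℂ) - ((U₀ b : Matrix.specialUnitaryGroup n ℂ) : Matrix n n ℂ)‖ ^ 2) (fun b => sq_nonneg _)
    (mul_nonneg hC0 hm0) hm0 hmη0 hCreg (by positivity : (0 : ℝ) < ((P.L : ℝ) ^ k) ^ 3) hq (fun c => norm_nonneg _) hρ0 hρs hreg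


/-! ## §2 ★★ The consumable forms: mean-value input over an ARBITRARY stencil (overlap `ν`) -/

/-- ★★ **FLAT DATUM, `ℓ²`, STENCIL MEAN-VALUE INPUT**: `k ≤ m + K`; `W` with `avg^k W = 1`; local radii `0 ≤ ρ_c ≤ s` dominating `‖W_b − 1‖` on the two `k`-blocks of `c`; smallness rows at
`s`; a stencil relation `S c b` of overlap `ν` (`Σ_c 𝟙[S c b] ≤ ν`) and the displayed input `ρ_c² ≤ C_reg·(Lᵏ)⁻³·Σ_{b : S c b}‖W_b − 1‖²`.  THEN
`Σ_c‖Q^{(k)}(W − 1)(c)‖² ≤ (C₂(d+1)Lᵏ)²·((d+1)Lᵏ·s + 0)²·(C_reg·((Lᵏ)³)⁻¹)·(ν·Σ_b‖W_b − 1‖²)` — `O(ε₂²)·ν∕(2d)`-times the two-block form, k-UNIFORM for `ν` independent of `k`.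
[cite: Balaban1985Averaging, Prop. 4 (134)–(135) p.38, Prop. 5 (156)–(157) p.42; Balaban1987RG1, (0.4)+(0.11) p.253] -/
theorem sum_normSq_linAvgIterM_sub_one_le_of_localReg_stencil {k : ℕ} (hk : k ≤ P.m + P.K)
    (W : GaugeField P 0 (Matrix.specialUnitaryGroup n ℂ))
    (hfib : ∀ c : PBond P k, Averaging.iter (fun i => blockAvg (P := P) (j := i) (expMeanLogSU (n := n))) k W c = 1)
    (S : PBond P k → PBond P 0 → Prop) [∀ c b, Decidable (S c b)] {ν : ℝ}
    (hν : ∀ b : PBond P 0, ∑ c : PBond P k, (if S c b then (1 : ℝ) else 0) ≤ ν)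
    {s Creg : ℝ} (hCreg : 0 ≤ Creg) (ρ : PBond P k → ℝ) (hρ0 : ∀ c, 0 ≤ ρ c) (hρs : ∀ c, ρ c ≤ s)
    (hρ : ∀ (c : PBond P k) (b : PBond P 0), (iterBlockOf k b.src = c.src ∨ iterBlockOf k b.src = c.tgt) → (iterBlockOf k b.tgt = c.src ∨ iterBlockOf k b.tgt = c.tgt) →
      ‖((W b : Matrix.specialUnitaryGroup n ℂ) : Matrix n n ℂ) - 1‖ ≤ ρ c)
    (hreg : ∀ c : PBond P k, ρ c ^ 2 ≤ Creg * (((P.L : ℝ) ^ k) ^ 3)⁻¹ * ∑ b : PBond P 0,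
        (if S c b then ‖((W b : Matrix.specialUnitaryGroup n ℂ) : Matrix n n ℂ) - 1‖ ^ 2 else 0))
    (h200 : 200 * (((P.d + 2) * P.L : ℕ) : ℝ) * (((P.d : ℝ) + 1) * (P.L : ℝ) ^ k * s) ≤ 1)
    (hm : (((P.d : ℝ) + 1) * ((18 : ℝ) ^ P.d * (2 + ((P.d : ℝ) + 1) * (18 : ℝ) ^ P.d)) * (5200 * (((P.d + 2) * P.L : ℕ) : ℝ) ^ 2) /
        ((P.L : ℝ) * ((P.L : ℝ) - 1))) * (((P.d : ℝ) + 1) * (P.L : ℝ) ^ k * s) ≤ 1)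
    (hNδ : 4 * (((P.d + 2) * P.L : ℕ) : ℝ) * (((P.d : ℝ) + 1) * (P.L : ℝ) ^ k * s) < deltaSU n) :
    ∑ c : PBond P k, ‖linAvgIterM k (fun b => ((W b : Matrix.specialUnitaryGroup n ℂ) : Matrix n n ℂ) - 1) c‖ ^ 2
      ≤ ((((P.d : ℝ) + 1) * ((18 : ℝ) ^ P.d * (2 + ((P.d : ℝ) + 1) * (18 : ℝ) ^ P.d)) * (5200 * (((P.d + 2) * P.L : ℕ) : ℝ) ^ 2) /
            ((P.L : ℝ) * ((P.L : ℝ) - 1))) * (((P.d : ℝ) + 1) * (P.L : ℝ) ^ k)) ^ 2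
          * ((((P.d : ℝ) + 1) * (P.L : ℝ) ^ k) * s + 0) ^ 2 * (Creg * (((P.L : ℝ) ^ k) ^ 3)⁻¹)
          * (ν * ∑ b : PBond P 0, ‖((W b : Matrix.specialUnitaryGroup n ℂ) : Matrix n n ℂ) - 1‖ ^ 2) := by
  have hL1 : (1 : ℝ) < P.L := by exact_mod_cast P.hL.2
  have hL0 : (0 : ℝ) < P.L := by linarith
  have hLL : 0 < (P.L : ℝ) * ((P.L : ℝ) - 1) := mul_pos hL0 (by linarith)
  have hC0 : 0 ≤ (((P.d : ℝ) + 1) * ((18 : ℝ) ^ P.d * (2 + ((P.d : ℝ) + 1) * (18 : ℝ) ^ P.d)) * (5200 * (((P.d + 2) * P.L : ℕ) : ℝ) ^ 2) /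
      ((P.L : ℝ) * ((P.L : ℝ) - 1))) := div_nonneg (by positivity) hLL.le
  have hm0 : 0 ≤ ((P.d : ℝ) + 1) * (P.L : ℝ) ^ k := by positivity
  have hcast0 : (0 : ℝ) ≤ (((P.d + 2) * P.L : ℕ) : ℝ) := Nat.cast_nonneg _
  have hq : ∀ c : PBond P k, ‖linAvgIterM k (fun b => ((W b : Matrix.specialUnitaryGroup n ℂ) : Matrix n n ℂ) - 1) c‖
      ≤ ((((P.d : ℝ) + 1) * ((18 : ℝ) ^ P.d * (2 + ((P.d : ℝ) + 1) * (18 : ℝ) ^ P.d)) * (5200 * (((P.d + 2) * P.L : ℕ) : ℝ) ^ 2) /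
            ((P.L : ℝ) * ((P.L : ℝ) - 1))) * (((P.d : ℝ) + 1) * (P.L : ℝ) ^ k)) * ρ c * ((((P.d : ℝ) + 1) * (P.L : ℝ) ^ k) * ρ c + 0) := by
    intro c
    have hmono : ((P.d : ℝ) + 1) * (P.L : ℝ) ^ k * ρ c ≤ ((P.d : ℝ) + 1) * (P.L : ℝ) ^ k * s := mul_le_mul_of_nonneg_left (hρs c) hm0
    have h := Prop7FibreQDefect.norm_linAvgIterM_sub_one_le_of_iter_eq_one (n := n) hk
      {x : Site P 0 | iterBlockOf k x = c.src ∨ iterBlockOf k x = c.tgt} c (fun x hx => hx) W (hfib c) (hρ0 c)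
      (fun b h1 h2 => hρ c b h1 h2)
      ((mul_le_mul_of_nonneg_left hmono (by positivity)).trans h200)
      ((mul_le_mul_of_nonneg_left hmono hC0).trans hm)
      (lt_of_le_of_lt (mul_le_mul_of_nonneg_left hmono (by positivity)) hNδ)
    calc _ ≤ _ := h
      _ = _ := by ring
  exact sum_sq_le_of_localSup_of_localReg_stencil S hν (fun c => ‖linAvgIterM k (fun b => ((W b : Matrix.specialUnitaryGroup n ℂ) : Matrix n n ℂ) - 1) c‖) ρ
    (fun b => ‖((W b : Matrix.specialUnitaryGroup n ℂ) : Matrix n n ℂ) - 1‖ ^ 2) (fun b => sq_nonneg _)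
    (mul_nonneg hC0 hm0) hm0 le_rfl hCreg (by positivity : (0 : ℝ) < ((P.L : ℝ) ^ k) ^ 3) hq (fun c => norm_nonneg _) hρ0 hρs hreg

/-- ★★ **CURVED BACKGROUND, STENCIL GAUGES BOND BY BOND, STENCIL MEAN-VALUE INPUT**: as `sum_normSq_linAvgIterM_gauged_sub_le_of_localReg`, with the mean-value input over an ARBITRARY
stencil relation `S` of overlap `ν` in place of the two blocks: `Σ_c‖Q^{(k)}(W^{σ_c} − U₀^{σ_c})(c)‖² ≤ (C₂(d+1)Lᵏ)²·((d+1)Lᵏs + (d+1)Lᵏη)²·(C_reg·((Lᵏ)³)⁻¹)·(ν·Σ_b‖W_b − U₀,b‖²)`.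
[cite: Balaban1985Averaging, (11)–(13) p.19, Prop. 4 (134)–(135) p.38, Prop. 5 (156)–(157) p.42; Balaban1987RG1, (0.4)+(0.11) p.253] -/
theorem sum_normSq_linAvgIterM_gauged_sub_le_of_localReg_stencil {k : ℕ} (hk : k ≤ P.m + P.K)
    (σ : PBond P k → GaugeTransf P 0 (Matrix.specialUnitaryGroup n ℂ))
    (W U₀ : GaugeField P 0 (Matrix.specialUnitaryGroup n ℂ))
    (hfib : ∀ c : PBond P k, Averaging.iter (fun i => blockAvg (P := P) (j := i) (expMeanLogSU (n := n))) k W c =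
      Averaging.iter (fun i => blockAvg (P := P) (j := i) (expMeanLogSU (n := n))) k U₀ c)
    (S : PBond P k → PBond P 0 → Prop) [∀ c b, Decidable (S c b)] {ν : ℝ}
    (hν : ∀ b : PBond P 0, ∑ c : PBond P k, (if S c b then (1 : ℝ) else 0) ≤ ν)
    {s η Creg : ℝ} (hη0 : 0 ≤ η) (hCreg : 0 ≤ Creg) (ρ : PBond P k → ℝ) (hρ0 : ∀ c, 0 ≤ ρ c) (hρs : ∀ c, ρ c ≤ s)
    (hU₀ : ∀ (c : PBond P k) (b : PBond P 0), (iterBlockOf k b.src = c.src ∨ iterBlockOf k b.src = c.tgt) → (iterBlockOf k b.tgt = c.src ∨ iterBlockOf k b.tgt = c.tgt) →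
      ‖((GaugeField.gaugeAct (σ c) U₀ b : Matrix.specialUnitaryGroup n ℂ) : Matrix n n ℂ) - 1‖ ≤ η)
    (hρ : ∀ (c : PBond P k) (b : PBond P 0), (iterBlockOf k b.src = c.src ∨ iterBlockOf k b.src = c.tgt) → (iterBlockOf k b.tgt = c.src ∨ iterBlockOf k b.tgt = c.tgt) →
      ‖((W b : Matrix.specialUnitaryGroup n ℂ) : Matrix n n ℂ) - ((U₀ b : Matrix.specialUnitaryGroup n ℂ) : Matrix n n ℂ)‖ ≤ ρ c)
    (hreg : ∀ c : PBond P k, ρ c ^ 2 ≤ Creg * (((P.L : ℝ) ^ k) ^ 3)⁻¹ * ∑ b : PBond P 0,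
        (if S c b then ‖((W b : Matrix.specialUnitaryGroup n ℂ) : Matrix n n ℂ) - ((U₀ b : Matrix.specialUnitaryGroup n ℂ) : Matrix n n ℂ)‖ ^ 2 else 0))
    (hmδ : (((P.d : ℝ) + 1) * ((18 : ℝ) ^ P.d * (2 + ((P.d : ℝ) + 1) * (18 : ℝ) ^ P.d)) * (324 * (((P.d + 2) * P.L : ℕ) : ℝ) ^ 2) /
        ((P.L : ℝ) * ((P.L : ℝ) - 1))) * (((P.d : ℝ) + 1) * (P.L : ℝ) ^ k * η) ≤ 1)
    (h200 : 200 * (((P.d + 2) * P.L : ℕ) : ℝ) * (((P.d : ℝ) + 1) * (P.L : ℝ) ^ k * s + ((P.d : ℝ) + 1) * (P.L : ℝ) ^ k * η) ≤ 1)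
    (hm : (((P.d : ℝ) + 1) * ((18 : ℝ) ^ P.d * (2 + ((P.d : ℝ) + 1) * (18 : ℝ) ^ P.d)) * (5200 * (((P.d + 2) * P.L : ℕ) : ℝ) ^ 2) /
        ((P.L : ℝ) * ((P.L : ℝ) - 1))) * (((P.d : ℝ) + 1) * (P.L : ℝ) ^ k * s + ((P.d : ℝ) + 1) * (P.L : ℝ) ^ k * η) ≤ 1)
    (hNδ : 4 * (((P.d + 2) * P.L : ℕ) : ℝ) * (((P.d : ℝ) + 1) * (P.L : ℝ) ^ k * s + ((P.d : ℝ) + 1) * (P.L : ℝ) ^ k * η) < deltaSU n) :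
    ∑ c : PBond P k, ‖linAvgIterM k (fun b => ((GaugeField.gaugeAct (σ c) W b : Matrix.specialUnitaryGroup n ℂ) : Matrix n n ℂ)
        - ((GaugeField.gaugeAct (σ c) U₀ b : Matrix.specialUnitaryGroup n ℂ) : Matrix n n ℂ)) c‖ ^ 2
      ≤ ((((P.d : ℝ) + 1) * ((18 : ℝ) ^ P.d * (2 + ((P.d : ℝ) + 1) * (18 : ℝ) ^ P.d)) * (5200 * (((P.d + 2) * P.L : ℕ) : ℝ) ^ 2) /
            ((P.L : ℝ) * ((P.L : ℝ) - 1))) * (((P.d : ℝ) + 1) * (P.L : ℝ) ^ k)) ^ 2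
          * ((((P.d : ℝ) + 1) * (P.L : ℝ) ^ k) * s + ((P.d : ℝ) + 1) * (P.L : ℝ) ^ k * η) ^ 2 * (Creg * (((P.L : ℝ) ^ k) ^ 3)⁻¹)
          * (ν * ∑ b : PBond P 0, ‖((W b : Matrix.specialUnitaryGroup n ℂ) : Matrix n n ℂ) - ((U₀ b : Matrix.specialUnitaryGroup n ℂ) : Matrix n n ℂ)‖ ^ 2) := by
  have hL1 : (1 : ℝ) < P.L := by exact_mod_cast P.hL.2
  have hL0 : (0 : ℝ) < P.L := by linarith
  have hLL : 0 < (P.L : ℝ) * ((P.L : ℝ) - 1) := mul_pos hL0 (by linarith)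
  have hC0 : 0 ≤ (((P.d : ℝ) + 1) * ((18 : ℝ) ^ P.d * (2 + ((P.d : ℝ) + 1) * (18 : ℝ) ^ P.d)) * (5200 * (((P.d + 2) * P.L : ℕ) : ℝ) ^ 2) /
      ((P.L : ℝ) * ((P.L : ℝ) - 1))) := div_nonneg (by positivity) hLL.le
  have hm0 : 0 ≤ ((P.d : ℝ) + 1) * (P.L : ℝ) ^ k := by positivity
  have hcast0 : (0 : ℝ) ≤ (((P.d + 2) * P.L : ℕ) : ℝ) := Nat.cast_nonneg _
  have hmη0 : 0 ≤ ((P.d : ℝ) + 1) * (P.L : ℝ) ^ k * η := by positivity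
  have hq : ∀ c : PBond P k, ‖linAvgIterM k (fun b => ((GaugeField.gaugeAct (σ c) W b : Matrix.specialUnitaryGroup n ℂ) : Matrix n n ℂ)
        - ((GaugeField.gaugeAct (σ c) U₀ b : Matrix.specialUnitaryGroup n ℂ) : Matrix n n ℂ)) c‖
      ≤ ((((P.d : ℝ) + 1) * ((18 : ℝ) ^ P.d * (2 + ((P.d : ℝ) + 1) * (18 : ℝ) ^ P.d)) * (5200 * (((P.d + 2) * P.L : ℕ) : ℝ) ^ 2) /
            ((P.L : ℝ) * ((P.L : ℝ) - 1))) * (((P.d : ℝ) + 1) * (P.L : ℝ) ^ k)) * ρ c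
          * ((((P.d : ℝ) + 1) * (P.L : ℝ) ^ k) * ρ c + ((P.d : ℝ) + 1) * (P.L : ℝ) ^ k * η) := by
    intro c
    have hmono : ((P.d : ℝ) + 1) * (P.L : ℝ) ^ k * ρ c + ((P.d : ℝ) + 1) * (P.L : ℝ) ^ k * η ≤ ((P.d : ℝ) + 1) * (P.L : ℝ) ^ k * s + ((P.d : ℝ) + 1) * (P.L : ℝ) ^ k * η :=
      add_le_add (mul_le_mul_of_nonneg_left (hρs c) hm0) le_rfl
    have h := norm_linAvgIterM_gauged_sub_le_of_iter_eq (n := n) hk (σ c)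
      {x : Site P 0 | iterBlockOf k x = c.src ∨ iterBlockOf k x = c.tgt} c (fun x hx => hx) W U₀ (hfib c) (hρ0 c) hη0
      (fun b h1 h2 => hU₀ c b h1 h2) (fun b h1 h2 => hρ c b h1 h2) hmδ
      ((mul_le_mul_of_nonneg_left hmono (by positivity)).trans h200)
      ((mul_le_mul_of_nonneg_left hmono hC0).trans hm)
      (lt_of_le_of_lt (mul_le_mul_of_nonneg_left hmono (by positivity)) hNδ)
    calc _ ≤ _ := h
      _ = _ := by ring
  exact sum_sq_le_of_localSup_of_localReg_stencil S hν
    (fun c => ‖linAvgIterM k (fun b => ((GaugeField.gaugeAct (σ c) W b : Matrix.specialUnitaryGroup n ℂ) : Matrix n n ℂ)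
        - ((GaugeField.gaugeAct (σ c) U₀ b : Matrix.specialUnitaryGroup n ℂ) : Matrix n n ℂ)) c‖) ρ
    (fun b => ‖((W b : Matrix.specialUnitaryGroup n ℂ) : Matrix n n ℂ) - ((U₀ b : Matrix.specialUnitaryGroup n ℂ) : Matrix n n ℂ)‖ ^ 2) (fun b => sq_nonneg _)
    (mul_nonneg hC0 hm0) hm0 hmη0 hCreg (by positivity : (0 : ℝ) < ((P.L : ℝ) ^ k) ^ 3) hq (fun c => norm_nonneg _) hρ0 hρs hreg


/-! ## §3 ★ The fibre-free form: the zeroth-order term DISPLAYED (serves the unpinned ∕ Landau branch, where `avg^k W = (avg^k U₀)^{h}`, `h = g↓ ≠ 1`) -/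

/-- ★ **THE LOCAL-GAUGE TWO-FIELD ROW WITHOUT THE FIBRE HYPOTHESIS**: `k ≤ m + K`, `σ` any finest gauge, `N ⊇ B^k(c₋) ∪ B^k(c₊)`, `W`, `U₀` ANY finest `SU(n)` fields with
`‖(U₀^σ)_b − 1‖ ≤ η` and `‖W_b − U₀,b‖ ≤ ρ` on the bonds inside `N`, smallness rows at `(ρ, η)`.  THEN
`‖(avg^k(W^σ)(c) − avg^k(U₀^σ)(c)) − Q^{(k)}(b ↦ (W^σ)_b − (U₀^σ)_b)(c)‖ ≤ C₂·m(ρ)·(m(ρ) + m(η))` — the increment of the gauged averages at `c` IS the framed linearised average of the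
increment, to second order in the LOCAL sup.  On a fibre pair the first term vanishes (`…Prop7FibreQDefect` §1); for the unpinned `ℓ²`-optimum it is the coarse pure gauge `h = g↓`
(`avg^k W = (avg^k U₀)^h`), displayed here rather than linearised. [cite: Balaban1985Averaging, (11)–(13) p.19, Prop. 4 (134)–(135) p.38, Prop. 5 (156)–(157) p.42; Balaban1987RG1, (0.4)+(0.11) p.253] -/
theorem norm_iterDiff_sub_linAvgIterM_gauged_le {k : ℕ} (hk : k ≤ P.m + P.K) (σ : GaugeTransf P 0 (Matrix.specialUnitaryGroup n ℂ))
    (N : Set (Site P 0)) (c : PBond P k) (hN : ∀ x : Site P 0, (iterBlockOf k x = c.src ∨ iterBlockOf k x = c.tgt) → x ∈ N)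
    (W U₀ : GaugeField P 0 (Matrix.specialUnitaryGroup n ℂ))
    {ρ η : ℝ} (hρ0 : 0 ≤ ρ) (hη0 : 0 ≤ η)
    (hU₀ : ∀ b : PBond P 0, b.src ∈ N → b.tgt ∈ N → ‖((GaugeField.gaugeAct σ U₀ b : Matrix.specialUnitaryGroup n ℂ) : Matrix n n ℂ) - 1‖ ≤ η)
    (hρ : ∀ b : PBond P 0, b.src ∈ N → b.tgt ∈ N → ‖((W b : Matrix.specialUnitaryGroup n ℂ) : Matrix n n ℂ) - ((U₀ b : Matrix.specialUnitaryGroup n ℂ) : Matrix n n ℂ)‖ ≤ ρ)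
    (hmδ : (((P.d : ℝ) + 1) * ((18 : ℝ) ^ P.d * (2 + ((P.d : ℝ) + 1) * (18 : ℝ) ^ P.d)) * (324 * (((P.d + 2) * P.L : ℕ) : ℝ) ^ 2) /
        ((P.L : ℝ) * ((P.L : ℝ) - 1))) * (((P.d : ℝ) + 1) * (P.L : ℝ) ^ k * η) ≤ 1)
    (h200 : 200 * (((P.d + 2) * P.L : ℕ) : ℝ) * (((P.d : ℝ) + 1) * (P.L : ℝ) ^ k * ρ + ((P.d : ℝ) + 1) * (P.L : ℝ) ^ k * η) ≤ 1)
    (hm : (((P.d : ℝ) + 1) * ((18 : ℝ) ^ P.d * (2 + ((P.d : ℝ) + 1) * (18 : ℝ) ^ P.d)) * (5200 * (((P.d + 2) * P.L : ℕ) : ℝ) ^ 2) /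
        ((P.L : ℝ) * ((P.L : ℝ) - 1))) * (((P.d : ℝ) + 1) * (P.L : ℝ) ^ k * ρ + ((P.d : ℝ) + 1) * (P.L : ℝ) ^ k * η) ≤ 1)
    (hNδ : 4 * (((P.d + 2) * P.L : ℕ) : ℝ) * (((P.d : ℝ) + 1) * (P.L : ℝ) ^ k * ρ + ((P.d : ℝ) + 1) * (P.L : ℝ) ^ k * η) < deltaSU n) :
    ‖(((Averaging.iter (fun i => blockAvg (P := P) (j := i) (expMeanLogSU (n := n))) k (GaugeField.gaugeAct σ W) c : Matrix.specialUnitaryGroup n ℂ) : Matrix n n ℂ)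
        - ((Averaging.iter (fun i => blockAvg (P := P) (j := i) (expMeanLogSU (n := n))) k (GaugeField.gaugeAct σ U₀) c : Matrix.specialUnitaryGroup n ℂ) : Matrix n n ℂ))
        - linAvgIterM k (fun b => ((GaugeField.gaugeAct σ W b : Matrix.specialUnitaryGroup n ℂ) : Matrix n n ℂ)
            - ((GaugeField.gaugeAct σ U₀ b : Matrix.specialUnitaryGroup n ℂ) : Matrix n n ℂ)) c‖
      ≤ (((P.d : ℝ) + 1) * ((18 : ℝ) ^ P.d * (2 + ((P.d : ℝ) + 1) * (18 : ℝ) ^ P.d)) * (5200 * (((P.d + 2) * P.L : ℕ) : ℝ) ^ 2) /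
          ((P.L : ℝ) * ((P.L : ℝ) - 1))) *
        ((((P.d : ℝ) + 1) * (P.L : ℝ) ^ k * ρ) * ((((P.d : ℝ) + 1) * (P.L : ℝ) ^ k * ρ) + (((P.d : ℝ) + 1) * (P.L : ℝ) ^ k * η))) := by
  classical
  set av : (i : ℕ) → Averaging P i (Matrix.specialUnitaryGroup n ℂ) := fun i => blockAvg (P := P) (j := i) (expMeanLogSU (n := n)) with hav
  have hQ0 : ∀ Y : PBond P 0 → Matrix n n ℂ, linAvgIterM 0 Y = Y := fun Y => LinearLiftMatrix.linAvgIterM_zero Y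
  have hQs : ∀ (i : ℕ) (Y : PBond P 0 → Matrix n n ℂ) (c : PBond P (i + 1)), linAvgIterM (i + 1) Y c = linAvg (linAvgIterM i Y) c :=
    fun i Y c => LinearLiftMatrix.linAvgIterM_succ i Y c
  let InN : PBond P 0 → Prop := fun b => b.src ∈ N ∧ b.tgt ∈ N
  let W₁ : GaugeField P 0 (Matrix.specialUnitaryGroup n ℂ) := fun b => if InN b then GaugeField.gaugeAct σ W b else 1
  let W₂ : GaugeField P 0 (Matrix.specialUnitaryGroup n ℂ) := fun b => if InN b then GaugeField.gaugeAct σ U₀ b else 1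
  have hW₁_in : ∀ b : PBond P 0, b.src ∈ N → b.tgt ∈ N → W₁ b = GaugeField.gaugeAct σ W b := fun b h1 h2 => if_pos ⟨h1, h2⟩
  have hW₂_in : ∀ b : PBond P 0, b.src ∈ N → b.tgt ∈ N → W₂ b = GaugeField.gaugeAct σ U₀ b := fun b h1 h2 => if_pos ⟨h1, h2⟩
  have hW₂_one : ∀ b, ‖((W₂ b : Matrix.specialUnitaryGroup n ℂ) : Matrix n n ℂ) - 1‖ ≤ η := by
    intro b
    by_cases hb : InN b
    · have e : W₂ b = GaugeField.gaugeAct σ U₀ b := if_pos hb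
      rw [e]; exact hU₀ b hb.1 hb.2
    · have e : W₂ b = 1 := if_neg hb
      rw [e]; simpa using hη0
  have hW₁_W₂ : ∀ b, ‖((W₁ b : Matrix.specialUnitaryGroup n ℂ) : Matrix n n ℂ) - ((W₂ b : Matrix.specialUnitaryGroup n ℂ) : Matrix n n ℂ)‖ ≤ ρ := by
    intro b
    by_cases hb : InN b
    · have e : W₁ b = GaugeField.gaugeAct σ W b := if_pos hb
      have e' : W₂ b = GaugeField.gaugeAct σ U₀ b := if_pos hb
      rw [e, e', CovLinAvgFrame.coe_gaugeAct, CovLinAvgFrame.coe_gaugeAct, ← sub_mul, ← mul_sub,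
        CStarRing.norm_mul_mem_unitary _ (Unitary.star_mem (σ b.tgt).2.1), CStarRing.norm_mem_unitary_mul _ (σ b.src).2.1]
      exact hρ b hb.1 hb.2
    · have e : W₁ b = 1 := if_neg hb
      have e' : W₂ b = 1 := if_neg hb
      rw [e, e', sub_self, norm_zero]; exact hρ0
  have h2f := EMLIterUniformAllL.norm_iter_sub_iter_sub_iterLin_le_uniform_allL linAvgIterM hQ0 hQs W₁ W₂ hη0 hρ0 hW₂_one hW₁_W₂ k hk hmδ h200 hm hNδ
  obtain ⟨-, hrow⟩ := h2f k le_rfl c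
  have h1 : Averaging.iter av k W₁ c = Averaging.iter av k (GaugeField.gaugeAct σ W) c :=
    AvgIterLocality.iter_blockAvg_congr₂_of_blocks_subset (expMeanLogSU (n := n)) hk N hW₁_in c hN
  have h2 : Averaging.iter av k W₂ c = Averaging.iter av k (GaugeField.gaugeAct σ U₀) c :=
    AvgIterLocality.iter_blockAvg_congr₂_of_blocks_subset (expMeanLogSU (n := n)) hk N hW₂_in c hN
  have hQ : linAvgIterM k (fun b => ((W₁ b : Matrix.specialUnitaryGroup n ℂ) : Matrix n n ℂ) - ((W₂ b : Matrix.specialUnitaryGroup n ℂ) : Matrix n n ℂ)) c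
      = linAvgIterM k (fun b => ((GaugeField.gaugeAct σ W b : Matrix.specialUnitaryGroup n ℂ) : Matrix n n ℂ)
        - ((GaugeField.gaugeAct σ U₀ b : Matrix.specialUnitaryGroup n ℂ) : Matrix n n ℂ)) c :=
    NewtonLiftFramed.linAvgIterM_congr₂_of_blocks_subset hk N _ _ (fun b hb1 hb2 => by simp only [hW₁_in b hb1 hb2, hW₂_in b hb1 hb2]) c hN
  rw [h1, h2, hQ] at hrow
  exact hrow

end Summit.QuantumFields.YangMills.Theorems.Prop7FibreQDefectEll2

end
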